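import Mathlib.MeasureTheory.Function.Jacobian
import Mathlib.LinearAlgebra.Matrix.BilinearForm
import Literature.Geometry.Lorentzian.AsymptoticallyFlatChart
import Literature.Geometry.Lorentzian.AFEndChartEmbedding
import Literature.Geometry.Lorentzian.AFEndCovering
import Literature.Geometry.Lorentzian.AsymptoticFlatnessChart
import Literature.Geometry.Lorentzian.VolumeChartFormula
import Literature.LinearAlgebra.Matrix.GramDeterminantTransform
import HarnessLib

/-!
# The Riemannian measure in the chart of an asymptotically flat end

`VolumeChartFormula.lean` proves the chart formula `dvol_h = √(det h_{ij}) dy` for the Riemannian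
measure `riemannianMeasure h` (`Volume.lean`: the Euclidean-normalised top-dimensional Hausdorff
measure of the length metric) in the charts `extChartAt I x` **of the atlas** of the manifold.
Integrals over an asymptotically flat end `e : AFEnd X` of a `3`-manifold, however, are computed
in the chart of the end, `Φ = e.dataChart : {R < ‖z‖} → X` (a diffeomorphism onto the open end,
not an atlas chart), in which the metric has the components `h_{ij} = hCoeff e D`
(`AsymptoticFlatness.lean`) — e.g. the mass integrals `∫_N R φ √g dx` of Schoen–Yau 1979,
Lemma 3.3 and (3.26)–(3.30), or `∫_N ‖Ric‖² dx` in (3.30). This file transports the chart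
formula to the chart of the end (all results proved, no named facts):

* `det_gram_comp`, `sqrt_det_gram_comp` — Gram determinants transform with `(det L)²`
  (`[B ∘ (L × L)] = [L]ᵀ [B] [L]`);
* `AFEnd.isOpenEmbedding_dataChart` (deprecated alias of `AFEnd.isOpenEmbedding_dataChart'`),
  `measurableEmbedding_dataChart`, `image_dataChartExt_eq`,
  `measurableSet_image_dataChartExt`, `injOn_dataChartExt`, `far_eq_image_dataChartExt` — the
  inverse chart (and its total extension `dataChartExt` of `AsymptoticallyFlatChart.lean`) as a
  measurable embedding; far regions `e.far R'` are images of `{R' < ‖z‖}`;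
* `AFEnd.continuousOn_hCoeff`, `continuousOn_sqrt_det_hCoeff` — continuity of the density;
* `AFEnd.abs_det_fderiv_mul_sqrt_det_chartGramMatrix` — **the Jacobian identity** between an
  atlas chart `c` and the chart of the end: `|det D(c ∘ Φ)(z)| √(det h^c_{ij}(c (Φ z))) =
  √(det h_{ij}(z))` (chain rule `dΦ = d(c⁻¹) ∘ D(c ∘ Φ)` and the Gram determinant);
* `AFEnd.exists_nhds_riemannianMeasure_image_dataChartExt` — the chart formula of the end
  **locally**: the atlas formula at `Φ z₀` transported along `c ∘ Φ` by the Euclidean change of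
  variables (Mathlib's `lintegral_image_eq_lintegral_abs_det_fderiv_mul`);
* `AFEnd.map_comap_dataChart_riemannianMeasure` — **the chart formula as an identity of measures
  on `ℝ³`**: `val_* Φ^* vol_h = √(det h_{ij}) · Leb|_{R < ‖z‖}` (local agreement on a countable
  cover, `Measure.ext_of_sUnion_eq_univ`);
* `AFEnd.riemannianMeasure_image_dataChartExt`, `riemannianMeasure_far` —
  `vol_h(Φ A) = ∫_A √(det h_{ij}) dz` for measurable `A ⊆ {R < ‖z‖}`, in particular for far
  regions;
* `AFEnd.setLIntegral_image_dataChartExt`, `setLIntegral_far` —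
  `∫_{Φ A} g dvol_h = ∫_A g(Φ z) √(det h_{ij}(z)) dz` for every `g : X → [0, ∞]`.

## References

* H. Federer, *Geometric Measure Theory*, Springer 1969, §3.2.3 (area formula), §3.2.46
  (Hausdorff measure of a Riemannian manifold = Riemannian volume).
* J. M. Lee, *Introduction to Riemannian Manifolds*, 2nd ed., Springer 2018, Prop. 2.41 ff.
  (`dV_g = √(det g_{ij}) dx`, independent of the chart).
* R. Schoen, S.-T. Yau, *On the proof of the positive mass conjecture in general relativity*,
  Comm. Math. Phys. 65 (1979) 45–76, Lemma 3.3, (3.26)–(3.30) (integrals over the end).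
-/

noncomputable section

open Manifold Bundle Set Filter Function TopologicalSpace MeasureTheory Measure Topology
open scoped ContDiff Topology ENNReal

namespace Literature.Geometry.Lorentzian

/-! ### Linear algebra: the Gram determinant of a transformed frame -/

section GramDet

variable {V : Type*} [AddCommGroup V] [Module ℝ V] {ι : Type*} [Fintype ι] [DecidableEq ι]

/-- **Gram determinants transform with the square of the determinant**: for a bilinear form
`B`, an endomorphism `L` and a basis `b`, `det (B(L bᵢ, L bⱼ)) = (det L)² det (B(bᵢ, bⱼ))`
(`[B ∘ (L × L)] = [L]ᵀ [B] [L]`, Mathlib's `LinearMap.BilinForm.toMatrix_comp`). This is the case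
`R = ℝ` of `Literature.LinearAlgebra.Matrix.det_gram_comp_eq_det_sq_mul` (Mathlib-only leaf
`Literature/LinearAlgebra/Matrix/GramDeterminantTransform.lean`), kept under this name for its
importers. [folklore] -/
theorem det_gram_comp (b : Module.Basis ι ℝ V) (B : LinearMap.BilinForm ℝ V) (L : V →ₗ[ℝ] V) :
    (Matrix.of fun i j ↦ B (L (b i)) (L (b j))).det =
      LinearMap.det L ^ 2 * (Matrix.of fun i j ↦ B (b i) (b j)).det :=
  Literature.LinearAlgebra.Matrix.det_gram_comp_eq_det_sq_mul b B L

/-- `√(det (B(L bᵢ, L bⱼ))) = |det L| √(det (B(bᵢ, bⱼ)))` (no sign condition is needed: both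
sides vanish when `det (B(bᵢ, bⱼ)) < 0`). [folklore] -/
theorem sqrt_det_gram_comp (b : Module.Basis ι ℝ V) (B : LinearMap.BilinForm ℝ V) (L : V →ₗ[ℝ] V) :
    Real.sqrt (Matrix.of fun i j ↦ B (L (b i)) (L (b j))).det =
      |LinearMap.det L| * Real.sqrt (Matrix.of fun i j ↦ B (b i) (b j)).det := by
  rw [det_gram_comp, Real.sqrt_mul (sq_nonneg _), Real.sqrt_sq_eq_abs]

end GramDet

namespace AFEnd

variable {X : Type} [TopologicalSpace X] [ChartedSpace E3 X] [IsManifold (𝓡 3) ∞ X]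
  (e : AFEnd X) (D : InitialDataSet (𝓡 3) X)

/-! ### The inverse chart as a measurable embedding -/

/-- The inverse chart `Φ : {R < ‖x‖} → X` of the end is an open embedding (a diffeomorphism onto
the open end `U` followed by the inclusion). Deprecated alias of
`AFEnd.isOpenEmbedding_dataChart'` (`AFEndChartEmbedding.lean`, the light-import home of this fact);
kept for importers. [folklore] -/
@[deprecated AFEnd.isOpenEmbedding_dataChart' (since := "2026-08-17")]
alias isOpenEmbedding_dataChart := isOpenEmbedding_dataChart'

omit [IsManifold (𝓡 3) ∞ X] in
/-- The inverse chart of the end is a measurable embedding (Borel structures). [folklore] -/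
theorem measurableEmbedding_dataChart [MeasurableSpace X] [BorelSpace X] :
    MeasurableEmbedding e.dataChart :=
  e.isOpenEmbedding_dataChart'.measurableEmbedding

omit [IsManifold (𝓡 3) ∞ X] in
/-- On subsets of the exterior region, the image under `dataChartExt` is the image under
`dataChart` of the corresponding subset of the subtype. [folklore] -/
theorem image_dataChartExt_eq {A : Set E3} (hA : A ⊆ {z | e.R < ‖z‖}) :
    e.dataChartExt '' A = e.dataChart '' (Subtype.val ⁻¹' A) := by
  ext p
  constructor
  · rintro ⟨z, hz, rfl⟩
    exact ⟨⟨z, hA hz⟩, hz, (e.dataChartExt_of_lt (hA hz)).symm⟩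
  · rintro ⟨y, hy, rfl⟩
    refine ⟨y, hy, ?_⟩
    rw [e.dataChartExt_of_lt y.2]

omit [IsManifold (𝓡 3) ∞ X] in
/-- Images of measurable subsets of the exterior region under `dataChartExt` are measurable.
[folklore] -/
theorem measurableSet_image_dataChartExt [MeasurableSpace X] [BorelSpace X] {A : Set E3}
    (hA : MeasurableSet A) (hA' : A ⊆ {z | e.R < ‖z‖}) : MeasurableSet (e.dataChartExt '' A) := by
  rw [e.image_dataChartExt_eq hA']
  exact e.measurableEmbedding_dataChart.measurableSet_image.2 (measurable_subtype_coe hA)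

omit [IsManifold (𝓡 3) ∞ X] in
/-- `dataChartExt` is injective on the exterior region. [folklore] -/
theorem injOn_dataChartExt : InjOn e.dataChartExt {z | e.R < ‖z‖} := by
  intro z₁ h₁ z₂ h₂ h
  rw [e.dataChartExt_of_lt (show e.R < ‖z₁‖ from h₁),
    e.dataChartExt_of_lt (show e.R < ‖z₂‖ from h₂)] at h
  exact congrArg Subtype.val (e.dataChart_injective h)

omit [IsManifold (𝓡 3) ∞ X] in
/-- **The far region `{R' < r}` is the image of `{R' < ‖z‖}` under the inverse chart**
(`R ≤ R'`). [folklore] -/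
theorem far_eq_image_dataChartExt {R' : ℝ} (hR' : e.R ≤ R') :
    e.far R' = e.dataChartExt '' {z | R' < ‖z‖} := by
  ext p
  rw [e.mem_far_iff]
  constructor
  · rintro ⟨z, hz, rfl⟩
    exact ⟨z, hz, e.dataChartExt_of_lt z.2⟩
  · rintro ⟨z, hz, rfl⟩
    exact ⟨⟨z, hR'.trans_lt hz⟩, hz, (e.dataChartExt_of_lt (hR'.trans_lt hz)).symm⟩

/-! ### The density `√(det h_ij)` -/

/-- The chart components of the metric are continuous on the exterior region. [folklore] -/
theorem continuousOn_hCoeff : ContinuousOn (hCoeff e D) {z | e.R < ‖z‖} := fun _z hz ↦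
  (e.contDiffAt_hCoeff D hz).continuousAt.continuousWithinAt

/-- The density `√(det h_{ij})` of the Riemannian measure in the chart is continuous on the
exterior region. [folklore] -/
theorem continuousOn_sqrt_det_hCoeff :
    ContinuousOn (fun z ↦ ENNReal.ofReal (Real.sqrt (Matrix.of fun i j ↦
      hCoeff e D z (EuclideanSpace.single i 1) (EuclideanSpace.single j 1)).det)) {z | e.R < ‖z‖} := by
  have hM : ContinuousOn (fun z ↦ (Matrix.of fun i j ↦
      hCoeff e D z (EuclideanSpace.single i 1) (EuclideanSpace.single j 1) : Matrix (Fin 3) (Fin 3) ℝ))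
      {z | e.R < ‖z‖} := by
    refine continuousOn_pi.2 fun i ↦ continuousOn_pi.2 fun j ↦ ?_
    exact ((ContinuousLinearMap.apply ℝ ℝ (EuclideanSpace.single j 1)).continuous.comp
      (ContinuousLinearMap.apply ℝ (E3 →L[ℝ] ℝ) (EuclideanSpace.single i 1)).continuous)
      |>.comp_continuousOn (e.continuousOn_hCoeff D)
  exact ENNReal.continuous_ofReal.comp_continuousOn
    (Real.continuous_sqrt.comp_continuousOn ((continuous_id.matrix_det).comp_continuousOn hM))

/-! ### The Jacobian identity between an atlas chart and the chart of the end -/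

/-- **Change of chart in the volume density.** Let `c = extChartAt p` be an atlas chart of `X`,
`Φ = dataChartExt` the inverse chart of the end and `ψ = c ∘ Φ` the transition map (a local
diffeomorphism of `ℝ³` near every `z` of the exterior region with `Φ z ∈ c.source`). Then
`|det Dψ(z)| √(det h^c_{ij}(ψ z)) = √(det h_{ij}(z))`, where `h^c_{ij}` is the Gram matrix of the
coordinate frame of `c` (`chartGramMatrix`) and `h_{ij} = hCoeff e D` that of the end: by the
chain rule `dΦ = d(c⁻¹) ∘ Dψ`, so `(h_{ij}) = [Dψ]ᵀ (h^c_{ij}) [Dψ]` (`sqrt_det_gram_comp`).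
Lee 2018, Prop. 2.41 ff. (independence of `√(det g) dx` of the chart). [folklore] -/
theorem abs_det_fderiv_mul_sqrt_det_chartGramMatrix (p : X) {z : E3} (hz : e.R < ‖z‖)
    (hsrc : e.dataChartExt z ∈ (extChartAt (𝓡 3) p).source) :
    |(fderiv ℝ (fun z ↦ extChartAt (𝓡 3) p (e.dataChartExt z)) z).det| *
        Real.sqrt (chartGramMatrix D.h p (extChartAt (𝓡 3) p (e.dataChartExt z))).det =
      Real.sqrt (Matrix.of fun i j ↦
        hCoeff e D z (EuclideanSpace.single i 1) (EuclideanSpace.single j 1)).det := by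
  set c := extChartAt (𝓡 3) p with hc_def
  set Φ := e.dataChartExt with hΦ_def
  set ψ : E3 → E3 := fun z ↦ c (Φ z) with hψ_def
  -- differentiability of the three maps
  have hΦd : MDifferentiableAt 𝓘(ℝ, E3) (𝓡 3) Φ z :=
    (e.contMDiffAt_dataChartExt hz).mdifferentiableAt (by simp)
  have hsrc' : Φ z ∈ (chartAt E3 p).source := by rwa [← extChartAt_source (𝓡 3)]
  have hcd : MDifferentiableAt (𝓡 3) 𝓘(ℝ, E3) c (Φ z) := mdifferentiableAt_extChartAt hsrc'
  have htgt : ψ z ∈ c.target := c.map_source hsrc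
  have hcsd : MDifferentiableAt 𝓘(ℝ, E3) (𝓡 3) c.symm (ψ z) := by
    have := mdifferentiableWithinAt_extChartAt_symm htgt
    rwa [ModelWithCorners.range_eq_univ, mdifferentiableWithinAt_univ] at this
  have hψd : MDifferentiableAt 𝓘(ℝ, E3) 𝓘(ℝ, E3) ψ z := hcd.comp z hΦd
  have hψfd : mfderiv 𝓘(ℝ, E3) 𝓘(ℝ, E3) ψ z = fderiv ℝ ψ z := mfderiv_eq_fderiv
  -- the chain rule `dΦ = d(c⁻¹) ∘ Dψ`
  have heq : c.symm (ψ z) = Φ z := c.left_inv hsrc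
  have hev : Φ =ᶠ[𝓝 z] (c.symm ∘ ψ) := by
    have h1 : ∀ᶠ z' in 𝓝 z, Φ z' ∈ c.source :=
      hΦd.continuousAt.preimage_mem_nhds ((isOpen_extChartAt_source (I := 𝓡 3) p).mem_nhds hsrc)
    filter_upwards [h1] with z' hz'
    exact (c.left_inv hz').symm
  set L₁ : E3 →L[ℝ] E3 := mfderiv 𝓘(ℝ, E3) (𝓡 3) c.symm (ψ z) with hL₁
  set L₂ : E3 →L[ℝ] E3 := fderiv ℝ ψ z with hL₂
  have hchain : ∀ v : E3, mfderiv 𝓘(ℝ, E3) (𝓡 3) Φ z v = L₁ (L₂ v) := by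
    have h := ((hcsd.hasMFDerivAt.comp z hψd.hasMFDerivAt).congr_of_eventuallyEq hev).mfderiv
    intro v
    rw [h, hψfd]
    rfl
  -- the metric at `Φ z`, as a bilinear form on `ℝ³`, composed with `L₁`
  set hin : E3 →L[ℝ] E3 →L[ℝ] ℝ := D.h.inner (Φ z) with hhin
  set B : LinearMap.BilinForm ℝ E3 := LinearMap.mk₂ ℝ (fun v w ↦ hin (L₁ v) (L₁ w))
    (fun v₁ v₂ w ↦ by simp only [map_add, FunLike.coe_add, Pi.add_apply])
    (fun a v w ↦ by simp only [map_smul, FunLike.coe_smul, Pi.smul_apply, smul_eq_mul])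
    (fun v w₁ w₂ ↦ by simp only [map_add])
    (fun a v w ↦ by simp only [map_smul, smul_eq_mul]) with hB
  have hB_apply : ∀ v w, B v w = hin (L₁ v) (L₁ w) := fun v w ↦ rfl
  set b := (EuclideanSpace.basisFun (Fin 3) ℝ).toBasis with hb
  have hb_apply : ∀ i, b i = EuclideanSpace.single i 1 := fun i ↦ by
    rw [hb, OrthonormalBasis.coe_toBasis, EuclideanSpace.basisFun_apply]
  -- the Gram matrix of the end
  have hgram_entry : ∀ i j : Fin 3,
      hCoeff e D z (EuclideanSpace.single i 1) (EuclideanSpace.single j 1) =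
        hin (L₁ (L₂ (EuclideanSpace.single i 1))) (L₁ (L₂ (EuclideanSpace.single j 1))) := by
    intro i j
    have h1 : hCoeff e D z (EuclideanSpace.single i 1) (EuclideanSpace.single j 1) =
        D.h.inner (e.dataChart ⟨z, hz⟩)
          (mfderiv (𝓡 3) (𝓡 3) e.dataChart ⟨z, hz⟩ (EuclideanSpace.single i 1))
          (mfderiv (𝓡 3) (𝓡 3) e.dataChart ⟨z, hz⟩ (EuclideanSpace.single j 1)) := by
      rw [hCoeff_of_lt D hz]
      rfl
    rw [h1, e.mfderiv_dataChart_eq, e.mfderiv_dataChart_eq, ← e.dataChartExt_of_lt hz]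
    show hin (mfderiv 𝓘(ℝ, E3) (𝓡 3) Φ z (EuclideanSpace.single i 1))
      (mfderiv 𝓘(ℝ, E3) (𝓡 3) Φ z (EuclideanSpace.single j 1)) = _
    rw [hchain, hchain]
  have hgram : (Matrix.of fun i j ↦
      hCoeff e D z (EuclideanSpace.single i 1) (EuclideanSpace.single j 1)) =
      Matrix.of fun i j ↦ B ((L₂ : E3 →ₗ[ℝ] E3) (b i)) ((L₂ : E3 →ₗ[ℝ] E3) (b j)) := by
    ext i j
    rw [Matrix.of_apply, Matrix.of_apply, hB_apply, ContinuousLinearMap.coe_coe, hb_apply,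
      hb_apply, hgram_entry]
  -- the Gram matrix of the atlas chart
  have hchart : chartGramMatrix D.h p (ψ z) = Matrix.of fun i j ↦ B (b i) (b j) := by
    ext i j
    rw [Matrix.of_apply, hB_apply, hb_apply, hb_apply, chartGramMatrix, Matrix.of_apply]
    simp only [ModelWithCorners.range_eq_univ, mfderivWithin_univ]
    rw [heq]
    rfl
  rw [hgram, hchart, sqrt_det_gram_comp b B (L₂ : E3 →ₗ[ℝ] E3)]

/-! ### The chart formula, locally -/

/-- **The chart formula near each point of the exterior region**: every `z₀` with `R < ‖z₀‖`
has an open neighbourhood `W ⊆ {R < ‖z‖}` such that for every measurable `A ⊆ W`,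
`vol_h(Φ A) = ∫_A √(det h_{ij}) dz` — the chart formula of `VolumeChartFormula.lean` in an atlas
chart `c` at `Φ z₀` (`riemannianMeasure_eq_integral_sqrt_det_holds`), transported along the
transition map `c ∘ Φ` by the Euclidean change of variables (Mathlib's
`lintegral_image_eq_lintegral_abs_det_fderiv_mul`) and the Jacobian identity
`abs_det_fderiv_mul_sqrt_det_chartGramMatrix`. Federer 1969, §3.2.3, §3.2.46; Lee 2018,
Prop. 2.41. [cite: Federer1969, §3.2.3 and §3.2.46] -/
theorem exists_nhds_riemannianMeasure_image_dataChartExt [T2Space X] [LocallyCompactSpace X]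
    [MeasurableSpace X] [BorelSpace X] {z₀ : E3} (hz₀ : e.R < ‖z₀‖) :
    ∃ W : Set E3, IsOpen W ∧ z₀ ∈ W ∧ W ⊆ {z | e.R < ‖z‖} ∧
      ∀ A ⊆ W, MeasurableSet A →
        riemannianMeasure D.h (e.dataChartExt '' A) =
          ∫⁻ z in A, ENNReal.ofReal (Real.sqrt (Matrix.of fun i j ↦
            hCoeff e D z (EuclideanSpace.single i 1) (EuclideanSpace.single j 1)).det) := by
  set p₀ := e.dataChartExt z₀ with hp₀
  set c := extChartAt (𝓡 3) p₀ with hc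
  have hcont : ContinuousOn e.dataChartExt {z | e.R < ‖z‖} := fun z hz ↦
    (e.contMDiffAt_dataChartExt hz).continuousAt.continuousWithinAt
  refine ⟨{z | e.R < ‖z‖} ∩ e.dataChartExt ⁻¹' c.source,
    hcont.isOpen_inter_preimage (isOpen_lt continuous_const continuous_norm)
      (isOpen_extChartAt_source (I := 𝓡 3) p₀),
    ⟨hz₀, mem_extChartAt_source (I := 𝓡 3) p₀⟩, inter_subset_left, ?_⟩
  intro A hAW hA
  have hAext : A ⊆ {z | e.R < ‖z‖} := fun z hz ↦ (hAW hz).1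
  have hAsrc : e.dataChartExt '' A ⊆ c.source := by
    rintro _ ⟨z, hz, rfl⟩
    exact (hAW hz).2
  have hS : MeasurableSet (e.dataChartExt '' A) := e.measurableSet_image_dataChartExt hA hAext
  rw [riemannianMeasure_eq_integral_sqrt_det_holds D.h p₀ hS hAsrc]
  set ψ : E3 → E3 := fun z ↦ c (e.dataChartExt z) with hψ
  have himage : c '' (e.dataChartExt '' A) = ψ '' A := image_image _ _ _
  have hdiff : ∀ z ∈ A, HasFDerivWithinAt ψ (fderiv ℝ ψ z) A z := by
    intro z hz
    have hΦd : MDifferentiableAt 𝓘(ℝ, E3) (𝓡 3) e.dataChartExt z :=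
      (e.contMDiffAt_dataChartExt (hAW hz).1).mdifferentiableAt (by simp)
    have hsrc' : e.dataChartExt z ∈ (chartAt E3 p₀).source := by
      rw [← extChartAt_source (𝓡 3)]
      exact (hAW hz).2
    have hψd : MDifferentiableAt 𝓘(ℝ, E3) 𝓘(ℝ, E3) ψ z :=
      (mdifferentiableAt_extChartAt hsrc').comp z hΦd
    exact (mdifferentiableAt_iff_differentiableAt.1 hψd).hasFDerivAt.hasFDerivWithinAt
  have hinj : InjOn ψ A := by
    intro z₁ h₁ z₂ h₂ h
    exact e.injOn_dataChartExt (hAW h₁).1 (hAW h₂).1 (c.injOn (hAW h₁).2 (hAW h₂).2 h)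
  rw [himage, lintegral_image_eq_lintegral_abs_det_fderiv_mul volume hA hdiff hinj]
  refine setLIntegral_congr_fun hA fun z hz ↦ ?_
  rw [← ENNReal.ofReal_mul (abs_nonneg _),
    e.abs_det_fderiv_mul_sqrt_det_chartGramMatrix D p₀ (hAW hz).1 (hAW hz).2]

/-! ### The chart formula for the Riemannian measure of the end -/

/-- **The Riemannian measure of the end in its chart, as an identity of measures on `ℝ³`**: the
pull-back of `vol_h` along the inverse chart `Φ : {R < ‖z‖} → X`, pushed to `ℝ³`, is Lebesgue
measure on `{R < ‖z‖}` with density `√(det h_{ij})`, `h_{ij} = hCoeff e D`. Both measures agree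
on the members of a countable cover of `{R < ‖z‖}` by the neighbourhoods of
`exists_nhds_riemannianMeasure_image_dataChartExt` (and vanish off `{R < ‖z‖}`), hence are equal
(`Measure.ext_of_sUnion_eq_univ`). Federer 1969, §3.2.46; Lee 2018, Prop. 2.41.
[cite: Federer1969, §3.2.46] -/
theorem map_comap_dataChart_riemannianMeasure [T2Space X] [LocallyCompactSpace X]
    [MeasurableSpace X] [BorelSpace X] :
    Measure.map (Subtype.val : exteriorRegion e.R → E3)
        (Measure.comap e.dataChart (riemannianMeasure D.h)) =
      (volume.restrict {z : E3 | e.R < ‖z‖}).withDensity fun z ↦ ENNReal.ofReal (Real.sqrt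
        (Matrix.of fun i j ↦ hCoeff e D z (EuclideanSpace.single i 1) (EuclideanSpace.single j 1)).det) := by
  classical
  set μ := riemannianMeasure D.h with hμ
  set dens : E3 → ℝ≥0∞ := fun z ↦ ENNReal.ofReal (Real.sqrt
    (Matrix.of fun i j ↦ hCoeff e D z (EuclideanSpace.single i 1) (EuclideanSpace.single j 1)).det)
    with hdens
  set Ext : Set E3 := {z | e.R < ‖z‖} with hExt
  have hExtm : MeasurableSet Ext := (isOpen_lt continuous_const continuous_norm).measurableSet
  -- the values of the two measures on measurable sets
  have hκ : ∀ s : Set E3, MeasurableSet s →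
      Measure.map (Subtype.val : exteriorRegion e.R → E3) (Measure.comap e.dataChart μ) s =
        μ (e.dataChartExt '' (s ∩ Ext)) := by
    intro s hs
    have hpre : (Subtype.val ⁻¹' s : Set (exteriorRegion e.R)) = Subtype.val ⁻¹' (s ∩ Ext) := by
      ext y
      exact ⟨fun hy ↦ ⟨hy, y.2⟩, fun hy ↦ hy.1⟩
    rw [Measure.map_apply measurable_subtype_coe hs, e.measurableEmbedding_dataChart.comap_apply,
      e.image_dataChartExt_eq inter_subset_right, hpre]
  have hlam : ∀ s : Set E3, MeasurableSet s →
      (volume.restrict Ext).withDensity dens s = ∫⁻ z in s ∩ Ext, dens z := by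
    intro s hs
    rw [withDensity_apply _ hs, Measure.restrict_restrict hs]
  -- a countable cover by neighbourhoods where the chart formula holds
  choose W hWo hWz hWsub hW using fun (z : E3) (hz : e.R < ‖z‖) ↦
    e.exists_nhds_riemannianMeasure_image_dataChartExt D hz
  set f : E3 → Set E3 := fun z ↦ if hz : e.R < ‖z‖ then W z hz else univ with hf
  have hfW : ∀ {z : E3} (hz : e.R < ‖z‖), f z = W z hz := fun hz ↦ dif_pos hz
  have hfn : ∀ z ∈ Ext, f z ∈ 𝓝[Ext] z := fun z hz ↦ by
    rw [hfW hz]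
    exact mem_nhdsWithin_of_mem_nhds ((hWo z hz).mem_nhds (hWz z hz))
  obtain ⟨t, htExt, htc, hcover⟩ := TopologicalSpace.countable_cover_nhdsWithin hfn
  refine Measure.ext_of_sUnion_eq_univ (S := insert Extᶜ (f '' t)) ((htc.image f).insert _) ?_ ?_
  · refine eq_univ_of_forall fun z ↦ ?_
    by_cases hz : z ∈ Ext
    · obtain ⟨x, hx, hzx⟩ := mem_iUnion₂.1 (hcover hz)
      exact ⟨f x, mem_insert_of_mem _ (mem_image_of_mem f hx), hzx⟩
    · exact ⟨Extᶜ, mem_insert _ _, hz⟩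
  · intro s hs
    rcases mem_insert_iff.1 hs with rfl | ⟨x, hx, rfl⟩
    · ext u hu
      rw [Measure.restrict_apply hu, Measure.restrict_apply hu, hκ _ (hu.inter hExtm.compl),
        hlam _ (hu.inter hExtm.compl), inter_assoc, compl_inter_self, inter_empty, image_empty,
        measure_empty, Measure.restrict_empty, lintegral_zero_measure]
    · have hxE : e.R < ‖x‖ := htExt hx
      ext u hu
      have hsub : u ∩ f x ⊆ W x hxE := fun z hz ↦ by rw [← hfW hxE]; exact hz.2
      have hum : MeasurableSet (u ∩ f x) := hu.inter (by rw [hfW hxE]; exact (hWo x hxE).measurableSet)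
      rw [Measure.restrict_apply hu, Measure.restrict_apply hu, hκ _ hum, hlam _ hum,
        inter_eq_left.2 ((hsub.trans (hWsub x hxE)))]
      exact hW x hxE _ hsub hum

/-- **`vol_h(Φ A) = ∫_A √(det h_{ij}) dz`** for every measurable `A ⊆ {R < ‖z‖}`: the Riemannian
measure of the image of `A` under the inverse chart of the end is the Lebesgue integral over `A`
of `√(det h_{ij})`, `h_{ij} = hCoeff e D` the chart components of the metric (evaluation of
`map_comap_dataChart_riemannianMeasure`). Federer 1969, §3.2.46; Lee 2018, Prop. 2.41
(`dV_g = √(det g_{ij}) dx`). [cite: Federer1969, §3.2.46] -/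
theorem riemannianMeasure_image_dataChartExt [T2Space X] [LocallyCompactSpace X]
    [MeasurableSpace X] [BorelSpace X] {A : Set E3} (hA : MeasurableSet A)
    (hA' : A ⊆ {z | e.R < ‖z‖}) :
    riemannianMeasure D.h (e.dataChartExt '' A) =
      ∫⁻ z in A, ENNReal.ofReal (Real.sqrt (Matrix.of fun i j ↦
        hCoeff e D z (EuclideanSpace.single i 1) (EuclideanSpace.single j 1)).det) := by
  have h : Measure.map (Subtype.val : exteriorRegion e.R → E3)
      (Measure.comap e.dataChart (riemannianMeasure D.h)) A =
      ((volume.restrict {z : E3 | e.R < ‖z‖}).withDensity fun z ↦ ENNReal.ofReal (Real.sqrt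
        (Matrix.of fun i j ↦
          hCoeff e D z (EuclideanSpace.single i 1) (EuclideanSpace.single j 1)).det)) A := by
    rw [e.map_comap_dataChart_riemannianMeasure D]
  rw [Measure.map_apply measurable_subtype_coe hA, e.measurableEmbedding_dataChart.comap_apply,
    ← e.image_dataChartExt_eq hA', withDensity_apply _ hA, Measure.restrict_restrict hA,
    inter_eq_left.2 hA'] at h
  exact h

/-- **The Riemannian measure of a far region**: `vol_h({R' < r}) = ∫_{R' < ‖z‖} √(det h_{ij}) dz`
for `R ≤ R'`. [cite: Federer1969, §3.2.46] -/
theorem riemannianMeasure_far [T2Space X] [LocallyCompactSpace X] [MeasurableSpace X]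
    [BorelSpace X] {R' : ℝ} (hR' : e.R ≤ R') :
    riemannianMeasure D.h (e.far R') =
      ∫⁻ z in {z : E3 | R' < ‖z‖}, ENNReal.ofReal (Real.sqrt (Matrix.of fun i j ↦
        hCoeff e D z (EuclideanSpace.single i 1) (EuclideanSpace.single j 1)).det) := by
  rw [e.far_eq_image_dataChartExt hR']
  exact e.riemannianMeasure_image_dataChartExt D
    (isOpen_lt continuous_const continuous_norm).measurableSet fun z hz ↦ hR'.trans_lt hz

/-! ### Integration over the end in the chart -/

/-- **Integration over the end in its chart**: for every `g : X → [0, ∞]` and every measurable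
`A ⊆ {R < ‖z‖}`, `∫_{Φ A} g dvol_h = ∫_A g(Φ z) √(det h_{ij}(z)) dz` (no measurability of `g` is
needed: `Φ` and the inclusion of the exterior region are measurable embeddings). Consequence of
`map_comap_dataChart_riemannianMeasure`. Federer 1969, §3.2.46; Lee 2018, Prop. 2.41.
[cite: Federer1969, §3.2.46] -/
theorem setLIntegral_image_dataChartExt [T2Space X] [LocallyCompactSpace X] [MeasurableSpace X]
    [BorelSpace X] (g : X → ℝ≥0∞) {A : Set E3} (hA : MeasurableSet A)
    (hA' : A ⊆ {z | e.R < ‖z‖}) :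
    ∫⁻ p in e.dataChartExt '' A, g p ∂riemannianMeasure D.h =
      ∫⁻ z in A, g (e.dataChartExt z) * ENNReal.ofReal (Real.sqrt (Matrix.of fun i j ↦
        hCoeff e D z (EuclideanSpace.single i 1) (EuclideanSpace.single j 1)).det) := by
  set μ := riemannianMeasure D.h with hμ
  set dens : E3 → ℝ≥0∞ := fun z ↦ ENNReal.ofReal (Real.sqrt
    (Matrix.of fun i j ↦ hCoeff e D z (EuclideanSpace.single i 1) (EuclideanSpace.single j 1)).det)
    with hdens
  have hExtm : MeasurableSet {z : E3 | e.R < ‖z‖} :=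
    (isOpen_lt continuous_const continuous_norm).measurableSet
  have hemb := e.measurableEmbedding_dataChart (X := X)
  have hval : MeasurableEmbedding (Subtype.val : exteriorRegion e.R → E3) :=
    MeasurableEmbedding.subtype_coe hExtm
  -- the left-hand side as an integral against the pulled-back measure
  have h1 : ∫⁻ p in e.dataChartExt '' A, g p ∂μ = ∫⁻ z in A, g (e.dataChartExt z)
      ∂(Measure.map (Subtype.val : exteriorRegion e.R → E3) (Measure.comap e.dataChart μ)) := by
    rw [Measure.restrict_map measurable_subtype_coe hA, hval.lintegral_map,
      hemb.restrict_comap, e.image_dataChartExt_eq hA']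
    have hfun : (fun y : exteriorRegion e.R ↦ g (e.dataChartExt (y : E3))) =
        fun y ↦ g (e.dataChart y) := funext fun y ↦ by rw [e.dataChartExt_of_lt y.2]
    rw [hfun, ← hemb.lintegral_map g, hemb.map_comap,
      Measure.restrict_restrict hemb.measurableSet_range,
      inter_eq_right.2 (image_subset_range _ _)]
  -- the right-hand side as an integral against Lebesgue measure with density
  have h2 : ∫⁻ z in A, g (e.dataChartExt z)
      ∂((volume.restrict {z : E3 | e.R < ‖z‖}).withDensity dens) =
      ∫⁻ z in A, g (e.dataChartExt z) * dens z := by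
    have hae : AEMeasurable dens ((volume.restrict {z : E3 | e.R < ‖z‖}).restrict A) := by
      rw [Measure.restrict_restrict hA]
      exact ((e.continuousOn_sqrt_det_hCoeff D).mono inter_subset_right).aemeasurable
        (hA.inter hExtm)
    rw [setLIntegral_withDensity_eq_setLIntegral_mul_non_measurable₀ _ hae _ hA
      (Eventually.of_forall fun _ ↦ ENNReal.ofReal_lt_top), Measure.restrict_restrict hA,
      inter_eq_left.2 hA']
    refine lintegral_congr fun z ↦ ?_
    rw [Pi.mul_apply, mul_comm]
  rw [h1, e.map_comap_dataChart_riemannianMeasure D, h2]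

/-- **Integration over a far region in the chart**: for `R ≤ R'` and every `g : X → [0, ∞]`,
`∫_{R' < r} g dvol_h = ∫_{R' < ‖z‖} g(Φ z) √(det h_{ij}(z)) dz`. [cite: Federer1969, §3.2.46] -/
theorem setLIntegral_far [T2Space X] [LocallyCompactSpace X] [MeasurableSpace X] [BorelSpace X]
    (g : X → ℝ≥0∞) {R' : ℝ} (hR' : e.R ≤ R') :
    ∫⁻ p in e.far R', g p ∂riemannianMeasure D.h =
      ∫⁻ z in {z : E3 | R' < ‖z‖}, g (e.dataChartExt z) * ENNReal.ofReal (Real.sqrt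
        (Matrix.of fun i j ↦ hCoeff e D z (EuclideanSpace.single i 1) (EuclideanSpace.single j 1)).det) := by
  rw [e.far_eq_image_dataChartExt hR']
  exact e.setLIntegral_image_dataChartExt D g
    (isOpen_lt continuous_const continuous_norm).measurableSet fun z hz ↦ hR'.trans_lt hz

end AFEnd

end Literature.Geometry.Lorentzian

end
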